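import Literature.MathematicalPhysics.QuantumFieldTheory.CurvatureGaussianField
import Literature.MathematicalPhysics.QuantumLattice.LatticeGaugeDLR
import HarnessLib

/-!
# Crux U `FreeProbeLawG` (stmt-QuantumFields-23756), line `birth` — assembly part A2c: box geometry and Green resummation algebra on `ℤ⁴`

Lead `ym-line-sgb-k1-g1`; helper toward the registered stub `stub_assembly`. Pure lattice bookkeeping (no measure, no gauge group):
* `exists_edgeBox` / `exists_plaqBox`: the finite sets of edges / plaquettes of `ℤ⁴` whose base point has all coordinates of modulus
  `≤ R` (packaged existentially, no definitions), with cardinality bounds;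
* `plaquetteCurl_resum`: for a `1`-form `ω` supported in a finite edge set `E`, `(dω)(q) = Σ_{e∈E} ω(e)·(dδ_e)(q)` — the algebra
  behind the Green resummation `⟨dω, Y⟩ = Σ_e ω(e) (d^*Y)(e)` of the line;
* support transport: if `ω` lives on the edge box of radius `R` then `dω` and every `plaquettesTouching {e}`, `e` in the box, live in
  the plaquette box of radius `R + 1`; `|dω(q)| ≤ 4 · max |ω|`-type `ℓ¹` bounds.
HONEST LABEL: RECORD rung R2ξ-G only; nothing here bears on the Yang–Mills mass gap.
References: S. Chatterjee, arXiv:1602.01222, §2 (lattice `d` on cochains) [arXiv160201222].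
-/

set_option autoImplicit false

noncomputable section

open Finset
open Literature.Probability.LatticeModels Literature.MathematicalPhysics.QuantumLattice
  Literature.MathematicalPhysics.QuantumFieldTheory

namespace Summit.QuantumFields.YangMills.Cruxes.FreeProbeLawG.SteinFree

namespace Resum

/-! ### Boxes of edges and plaquettes -/

/-- The edges of `ℤ⁴` with base point in the sup-norm ball of radius `R` form a finite set of cardinality `4(2R+1)⁴`. -/
theorem exists_edgeBox (R : ℕ) :
    ∃ E : Finset (ZdEdge 4), (∀ e : ZdEdge 4, e ∈ E ↔ ∀ k : Fin 4, |e.1 k| ≤ (R : ℤ)) ∧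
      (E.card : ℝ) ≤ 4 * (2 * (R : ℝ) + 1) ^ 4 := by
  classical
  refine ⟨(Fintype.piFinset fun _ : Fin 4 => Finset.Icc (-(R : ℤ)) R) ×ˢ (Finset.univ : Finset (Fin 4)), ?_, ?_⟩
  · intro e
    simp only [mem_product, Fintype.mem_piFinset, mem_Icc, mem_univ, and_true, abs_le]
  · rw [card_product, Fintype.card_piFinset, card_univ, Fintype.card_fin, prod_const, card_univ, Fintype.card_fin]
    have hc : (Finset.Icc (-(R : ℤ)) R).card = 2 * R + 1 := by
      rw [Int.card_Icc]; omega
    rw [hc]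
    push_cast
    nlinarith [sq_nonneg ((2 : ℝ) * R + 1), sq_nonneg (((2 : ℝ) * R + 1) ^ 2)]

/-- The plaquettes of `ℤ⁴` with base point in the sup-norm ball of radius `R` form a finite set of cardinality `≤ 6(2R+1)⁴`. -/
theorem exists_plaqBox (R : ℕ) :
    ∃ S : Finset (ZdPlaquette 4), (∀ q : ZdPlaquette 4, q ∈ S ↔ ∀ k : Fin 4, |q.1 k| ≤ (R : ℤ)) ∧
      (S.card : ℝ) ≤ 6 * (2 * (R : ℝ) + 1) ^ 4 := by
  classical
  refine ⟨(Fintype.piFinset fun _ : Fin 4 => Finset.Icc (-(R : ℤ)) R) ×ˢ Finset.univ, ?_, ?_⟩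
  · intro q
    simp only [mem_product, Fintype.mem_piFinset, mem_Icc, mem_univ, and_true, abs_le]
  · rw [card_product, Fintype.card_piFinset, prod_const, card_univ, Fintype.card_fin, card_univ]
    have hc : (Finset.Icc (-(R : ℤ)) R).card = 2 * R + 1 := by
      rw [Int.card_Icc]; omega
    have h6 : Fintype.card {p : Fin 4 × Fin 4 // p.1 < p.2} = 6 := by decide
    rw [hc, h6]
    push_cast
    nlinarith [sq_nonneg ((2 : ℝ) * R + 1), sq_nonneg (((2 : ℝ) * R + 1) ^ 2)]

/-! ### Coordinates of boundary edges -/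

/-- The base point of a boundary edge of `q` differs from the base point of `q` by at most `1` in each coordinate. -/
theorem abs_plaquetteBoundary_sub_le (q : ZdPlaquette 4) (i k : Fin 4) :
    |(plaquetteBoundary q i).1 k - q.1 k| ≤ 1 := by
  fin_cases i
  · simp [plaquetteBoundary]
  · simp only [plaquetteBoundary, Fin.mk_one, Matrix.cons_val_one, Matrix.cons_val_zero, Pi.add_apply, add_sub_cancel_left,
      Pi.single_apply]
    split_ifs <;> simp
  · simp only [plaquetteBoundary, Fin.reduceFinMk, Matrix.cons_val, Pi.add_apply, add_sub_cancel_left, Pi.single_apply]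
    split_ifs <;> simp
  · simp [plaquetteBoundary]

/-- If an edge of `q` lies in the edge box of radius `R` then `q` lies in the plaquette box of radius `R + 1`. -/
theorem plaq_mem_box_of_boundary (q : ZdPlaquette 4) (i : Fin 4) {R : ℤ}
    (h : ∀ k : Fin 4, |(plaquetteBoundary q i).1 k| ≤ R) (k : Fin 4) : |q.1 k| ≤ R + 1 := by
  have h1 := abs_plaquetteBoundary_sub_le q i k
  have h2 := h k
  have := abs_sub_abs_le_abs_sub (q.1 k) ((plaquetteBoundary q i).1 k)
  rw [abs_sub_comm] at this
  linarith

/-- Conversely the boundary edges of a plaquette in the box of radius `R` lie in the edge box of radius `R + 1`. -/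
theorem boundary_mem_box_of_plaq (q : ZdPlaquette 4) (i : Fin 4) {R : ℤ}
    (h : ∀ k : Fin 4, |q.1 k| ≤ R) (k : Fin 4) : |(plaquetteBoundary q i).1 k| ≤ R + 1 := by
  have h1 := abs_plaquetteBoundary_sub_le q i k
  have h2 := h k
  have := abs_sub_abs_le_abs_sub ((plaquetteBoundary q i).1 k) (q.1 k)
  linarith

/-! ### Green resummation algebra -/

/-- **Resummation of the curl against a finitely supported `1`-form**: `(dω)(q) = Σ_{e ∈ E} ω(e) (dδ_e)(q)` whenever `ω` vanishes
off `E`. -/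
theorem plaquetteCurl_resum {ω : ZdEdge 4 → ℝ} {E : Finset (ZdEdge 4)} (hω : ∀ e, ω e ≠ 0 → e ∈ E) (q : ZdPlaquette 4) :
    plaquetteCurl ω q = ∑ e ∈ E, ω e * plaquetteCurl (fun e' => if e' = e then (1 : ℝ) else 0) q := by
  classical
  simp only [plaquetteCurl, Finset.mul_sum]
  rw [Finset.sum_comm]
  refine Finset.sum_congr rfl fun i _ => ?_
  -- `σ_i ω(∂_i q) = Σ_{e∈E} ω e σ_i [∂_i q = e]`
  by_cases hmem : plaquetteBoundary q i ∈ E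
  · rw [Finset.sum_eq_single_of_mem (plaquetteBoundary q i) hmem]
    · simp [mul_comm]
    · intro e _ hne
      simp [Ne.symm hne]
  · have h0 : ω (plaquetteBoundary q i) = 0 := by
      by_contra h
      exact hmem (hω _ h)
    rw [h0, mul_zero]
    symm
    refine Finset.sum_eq_zero fun e he => ?_
    have : plaquetteBoundary q i ≠ e := fun h => hmem (h ▸ he)
    simp [this]

/-- If `ω` lives on the edge box of radius `R`, its curl lives on the plaquette box of radius `R + 1`. -/
theorem plaquetteCurl_eq_zero_of_not_box {ω : ZdEdge 4 → ℝ} {R : ℤ}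
    (hω : ∀ e, ω e ≠ 0 → ∀ k : Fin 4, |e.1 k| ≤ R) (q : ZdPlaquette 4) (hq : ¬ ∀ k : Fin 4, |q.1 k| ≤ R + 1) :
    plaquetteCurl ω q = 0 := by
  simp only [plaquetteCurl]
  refine Finset.sum_eq_zero fun i _ => ?_
  have : ω (plaquetteBoundary q i) = 0 := by
    by_contra h
    exact hq (plaq_mem_box_of_boundary q i (hω _ h))
  rw [this, mul_zero]

/-- The curl of an indicator `1`-form vanishes at plaquettes not containing the edge; in particular, for `e` in the edge box of
radius `R`, `(dδ_e)(q) ≠ 0` forces `q` into the plaquette box of radius `R + 1`. -/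
theorem plaquetteCurl_indicator_eq_zero {e : ZdEdge 4} {R : ℤ} (he : ∀ k : Fin 4, |e.1 k| ≤ R)
    (q : ZdPlaquette 4) (hq : ¬ ∀ k : Fin 4, |q.1 k| ≤ R + 1) :
    plaquetteCurl (fun e' => if e' = e then (1 : ℝ) else 0) q = 0 := by
  refine plaquetteCurl_eq_zero_of_not_box (R := R) (fun e' h => ?_) q hq
  by_cases h' : e' = e
  · subst h'; exact he
  · simp [h'] at h

/-- `plaquettesTouching {e}` lies in the plaquette box of radius `R + 1` when `e` lies in the edge box of radius `R`. -/
theorem plaquettesTouching_subset_box {e : ZdEdge 4} {R : ℤ} (he : ∀ k : Fin 4, |e.1 k| ≤ R)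
    {S : Finset (ZdPlaquette 4)} (hS : ∀ q : ZdPlaquette 4, (∀ k : Fin 4, |q.1 k| ≤ R + 1) → q ∈ S) :
    plaquettesTouching {e} ⊆ S := by
  intro q hq
  rw [mem_plaquettesTouching_iff] at hq
  obtain ⟨e', he'⟩ := hq
  rw [Finset.mem_inter, Finset.mem_singleton] at he'
  obtain ⟨he'q, rfl⟩ := he'
  rw [← image_plaquetteBoundary, Finset.mem_image] at he'q
  obtain ⟨i, _, hi⟩ := he'q
  exact hS q (plaq_mem_box_of_boundary q i (fun k => by rw [hi]; exact he k))

/-- `|(dω)(q)| ≤ 4 · C` when `|ω| ≤ C` on the boundary of `q`. -/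
theorem abs_plaquetteCurl_le {ω : ZdEdge 4 → ℝ} {C : ℝ} (q : ZdPlaquette 4) (hC : ∀ i : Fin 4, |ω (plaquetteBoundary q i)| ≤ C) :
    |plaquetteCurl ω q| ≤ 4 * C := by
  simp only [plaquetteCurl]
  refine (Finset.abs_sum_le_sum_abs _ _).trans ?_
  calc ∑ i : Fin 4, |plaquetteBoundarySign i * ω (plaquetteBoundary q i)| ≤ ∑ _i : Fin 4, C := by
        refine Finset.sum_le_sum fun i _ => ?_
        rw [abs_mul]
        have hs : |plaquetteBoundarySign i| = 1 := by
          fin_cases i <;> simp [plaquetteBoundarySign]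
        rw [hs, one_mul]
        exact hC i
    _ = 4 * C := by simp

/-- The `ℓ¹` norm of a finitely supported `1`-form dominates its values. -/
theorem abs_le_of_sum_le {ω : ZdEdge 4 → ℝ} {E : Finset (ZdEdge 4)} (hω : ∀ e, ω e ≠ 0 → e ∈ E) {C : ℝ}
    (hC : ∑ e ∈ E, |ω e| ≤ C) (e : ZdEdge 4) : |ω e| ≤ C := by
  classical
  by_cases h : ω e = 0
  · rw [h, abs_zero]
    exact le_trans (Finset.sum_nonneg fun _ _ => abs_nonneg _) hC
  · exact (Finset.single_le_sum (f := fun e => |ω e|) (fun _ _ => abs_nonneg _) (hω e h)).trans hC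

/-- The indicator direction: `Σ_{q'} c(q') · e_{(q',a)} = (q, b) ↦ [b = a] c(q)` on the block space `S → Fin D → ℝ`. -/
theorem sum_smul_basis_eq {ι : Type*} [Fintype ι] [DecidableEq ι] {D : ℕ} (c : ι → ℝ) (a : Fin D) :
    (∑ q' : ι, c q' • (fun (q : ι) (b : Fin D) => if q = q' ∧ b = a then (1 : ℝ) else 0)) =
      fun q b => if b = a then c q else 0 := by
  funext q b
  simp only [Finset.sum_apply, Pi.smul_apply, smul_eq_mul, mul_ite, mul_one, mul_zero]
  by_cases hb : b = a
  · simp [hb, Finset.sum_ite_eq]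
  · simp [hb]

end Resum

end Summit.QuantumFields.YangMills.Cruxes.FreeProbeLawG.SteinFree

end
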